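import Literature.AlgebraicGeometry.Resolution.FormalBranchesLocal
import Literature.AlgebraicGeometry.Resolution.AlterationsEnlargingZ
import Literature.AlgebraicGeometry.Resolution.RegularLocalRingsUFD
import Literature.AlgebraicGeometry.Resolution.RegularSystemOfParameters
import HarnessLib

/-!
# Formal branches of height-one primes in an analytically unramified regular local ring

Topic: `Literature/AlgebraicGeometry/Resolution`. Elementary local algebra behind the descent
of formally toroidal ("clean") presentations from the completion `Ô` of a regular local domain
`O` to `O` itself (Zariski's analytic branches, in the special case of monomials in a regular
system of parameters of `Ô`). Everything here is PROVED; no named facts. The descent lemmas are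
stated for a regular local domain `O` and any faithfully flat `O`-algebra `B` which is a domain
with `O → B` local (the case of interest is `B = Ô = AdicCompletion (maximalIdeal O) O`, a
regular local ring, Matsumura §19); "analytically unramified" means that `B/(f)` is reduced for
every prime element `f` of `O`. We write `ι = algebraMap O B`.

* `not_mem_sq_of_rsop` — members of a regular system of parameters lie outside `𝔪²`
  (Matsumura Thm. 17.10 through `RegularSystemOfParameters.lean`; they are pairwise
  non-associated prime elements by `prime_of_rsop`, `not_dvd_of_rsop` of
  `AlterationsEnlargingZ.lean`).
* `le_one_of_associated_pow_mul` — if `A/(g)` is reduced and `g ~ τ^b r` with `τ ∤ r`, then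
  `b ≤ 1` (`τ r` is nilpotent modulo `g`, so `τ^b r ∣ g ∣ τ r`).
* `descent_one_branch` — if `ι s = r τ^a` (`r` unit, `τ` prime of `B`, `a ≥ 1`) then `s = u f^a`
  with `u ∈ O^×` and `f` a prime of `O` with `ι f = w τ`, `w ∈ B^×`: a prime factor `f` of `s`
  has `ι f ~ τ^b`, `b = 1` by analytic unramifiedness, and `f^a ∣ s` by faithful flatness.
* `descent_two_branch` — `ι s = r τ₀^{a₀} τ₁^{a₁}` and `ι f = w τ₀`: peel `f^{a₀}` off and
  descend the branch `τ₁`, `s = u f^{a₀} f'^{a₁}`.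
* `descent_double_branch` — `ι s = r τ₀^{a₀} τ₁^{a₁}` and a prime `f` with `ι f = w τ₀ τ₁`:
  `a₀ = a₁` and `s = u f^{a₀}` (a left-over power of one `τ_i` would descend to a prime
  `f' ∣ f` with `ι f' ~ τ_i`, making the other `τ` a unit).
* `span_pair_eq_maximalIdeal` — `ι f_i = w_i τ_i` for `(τ₀, τ₁) = 𝔪 B` gives `(f₀, f₁) = 𝔪`.
* `nodal_congruence` — in `Ô`: `ι f = w τ₀ τ₁` gives `f ≡ c t₀ t₁ (mod 𝔪³)` for adapted
  parameters `ι t_j ≡ τ_j (mod 𝔪̂²)` (`exists_coord_adapted`) and a unit `c` with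
  `ι c ≡ w (mod 𝔪̂)`.

## Sources

* H. Matsumura, *Commutative Ring Theory*, CUP 1986: Thm. 14.2 p. 105, Thm. 14.3 p. 106,
  Thm. 17.8 and Thm. 17.10 p. 137 (regular systems of parameters: regularity of the quotients,
  domains, `A`-sequences, quasi-regularity); §19 p. 158 (the completion of a regular local ring
  is regular). [Matsumura1987]
-/

noncomputable section

open IsLocalRing

namespace Literature.AlgebraicGeometry.Resolution

universe u


/-! ## Regular systems of parameters: members lie outside `𝔪²` -/

/-- Members of a regular system of parameters lie outside `𝔪²` (the initial form `X_j` of `t_j`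
has a unit coefficient). [cite: Matsumura1987, Thm. 17.10] -/
theorem not_mem_sq_of_rsop {R : Type*} [CommRing R] [IsRegularLocalRing R]
    {d : ℕ} (t : Fin d → R) (ht : Ideal.span (Set.range t) = maximalIdeal R)
    (hd : ringKrullDim R = (d : WithBot ℕ∞)) (j : Fin d) : t j ∉ maximalIdeal R ^ 2 := by
  classical
  intro h
  have hd' := spanFinrank_maximalIdeal_eq_of_ringKrullDim_eq hd
  have key := coeff_mem_maximalIdeal_of_eval_mem_pow hd' t ht (MvPolynomial.isHomogeneous_X R j)
    (by rwa [MvPolynomial.eval_X]) (Finsupp.single j 1)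
  rw [MvPolynomial.coeff_X, if_pos rfl] at key
  exact (maximalIdeal.isMaximal R).ne_top ((Ideal.eq_top_iff_one _).mpr key)

/-- The ideal generated by a pair `t : Fin 2 → R` is `(t 0, t 1)`. [folklore] -/
theorem ideal_span_range_fin_two {R : Type*} [Semiring R] (t : Fin 2 → R) :
    Ideal.span (Set.range t) = Ideal.span {t 0, t 1} := by
  refine congrArg Ideal.span (Set.ext fun x => ?_)
  simp only [Set.mem_range, Fin.exists_fin_two, Set.mem_insert_iff, Set.mem_singleton_iff]
  exact or_congr eq_comm eq_comm

/-! ## Analytic unramifiedness bounds the exponents of formal branches -/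

/-- **Reducedness bounds exponents.** In a domain `A`, if `A/(g)` is reduced and
`g ~ τ ^ b * r` with `τ ≠ 0` and `τ ∤ r`, then `b ≤ 1`: `τ r` is nilpotent modulo `g`, hence
`τ^b r ∣ g ∣ τ r`, and `b ≥ 2` would give `τ ∣ r`. [folklore] -/
theorem le_one_of_associated_pow_mul {A : Type*} [CommRing A] [IsDomain A] {g τ r : A} {b : ℕ}
    (hred : IsReduced (A ⧸ Ideal.span {g})) (hg : Associated g (τ ^ b * r)) (hτ0 : τ ≠ 0)
    (hτr : ¬ τ ∣ r) : b ≤ 1 := by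
  by_contra hb
  obtain ⟨c, rfl⟩ : ∃ c, b = c + 2 := ⟨b - 2, by omega⟩
  have hrad : (Ideal.span {g}).IsRadical := (Ideal.isRadical_iff_quotient_reduced _).mpr hred
  have h1 : (τ * r) ^ (c + 3) ∈ Ideal.span {g} := by
    rw [Ideal.mem_span_singleton, mul_pow]
    exact hg.dvd.trans (mul_dvd_mul (pow_dvd_pow τ (by omega)) (dvd_pow_self r (by omega)))
  have h2 : τ * r ∈ Ideal.span {g} := hrad ⟨c + 3, h1⟩
  rw [Ideal.mem_span_singleton] at h2
  have h3 : τ * (τ ^ (c + 1) * r) ∣ τ * r := by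
    have h := hg.symm.dvd.trans h2
    rwa [show τ ^ (c + 2) * r = τ * (τ ^ (c + 1) * r) by ring] at h
  rw [mul_dvd_mul_iff_left hτ0] at h3
  exact hτr ((dvd_mul_of_dvd_left (dvd_pow_self τ (Nat.succ_ne_zero c)) r).trans h3)

/-! ## Descent along a faithfully flat local extension `O → B` into a domain -/

/-- `ι a ∣ ι b` implies `a ∣ b` for a faithfully flat `ι : O → B` (`(a) B ∩ O = (a)`).
[folklore] -/
theorem dvd_of_algebraMap_dvd {O B : Type*} [CommRing O] [CommRing B] [Algebra O B]
    [Module.FaithfullyFlat O B] {a b : O} (h : algebraMap O B a ∣ algebraMap O B b) : a ∣ b := by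
  have h' : b ∈ ((Ideal.span {a}).map (algebraMap O B)).comap (algebraMap O B) := by
    rw [Ideal.mem_comap, Ideal.map_span, Set.image_singleton, Ideal.mem_span_singleton]
    exact h
  rwa [Ideal.comap_map_eq_self_of_faithfullyFlat, Ideal.mem_span_singleton] at h'

/-- **Peeling an algebraic factor**: if `ι s = c · ι g` with `g ≠ 0`, then `s = s' g` with
`ι s' = c` (faithful flatness and cancellation in the domain `B`). [folklore] -/
theorem exists_eq_mul_of_algebraMap_eq_mul {O B : Type*} [CommRing O] [CommRing B] [IsDomain B]
    [Algebra O B] [Module.FaithfullyFlat O B] {s g : O} {c : B} (hg : g ≠ 0)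
    (hs : algebraMap O B s = c * algebraMap O B g) :
    ∃ s' : O, s = s' * g ∧ algebraMap O B s' = c := by
  have hdvd : g ∣ s := dvd_of_algebraMap_dvd ⟨c, by rw [hs, mul_comm]⟩
  obtain ⟨s', rfl⟩ := hdvd
  refine ⟨s', mul_comm _ _, ?_⟩
  have hg' : algebraMap O B g ≠ 0 := fun h =>
    hg (FaithfulSMul.algebraMap_injective O B (h.trans (map_zero _).symm))
  rw [map_mul, mul_comm] at hs
  exact mul_right_cancel₀ hg' hs

/-- A non-zero non-unit value `ι s` has a prime factor `f ∣ s` in the UFD `O` (a regular local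
domain). [cite: Matsumura1987, Thm. 20.3] -/
theorem exists_prime_dvd_of_algebraMap_eq {O B : Type*} [CommRing O] [IsRegularLocalRing O]
    [IsDomain O] [CommRing B] [Algebra O B] {s : O} {y : B} (hy0 : y ≠ 0) (hyu : ¬ IsUnit y)
    (hs : algebraMap O B s = y) : ∃ f : O, Prime f ∧ f ∣ s := by
  haveI : UniqueFactorizationMonoid O := uniqueFactorizationMonoid_of_isRegularLocalRing O ‹_›
  have hs0 : s ≠ 0 := by
    rintro rfl
    exact hy0 (by rw [← hs, map_zero])
  have hsu : ¬ IsUnit s := fun h => hyu (hs ▸ h.map (algebraMap O B))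
  obtain ⟨f, hf, hfs⟩ := WfDvdMonoid.exists_irreducible_factor hsu hs0
  exact ⟨f, UniqueFactorizationMonoid.irreducible_iff_prime.mp hf, hfs⟩

/-- **One formal branch descends.** If every prime `f₁` of `O` has `B/(f₁)` reduced and
`ι s = r τ^a` with `r ∈ B^×`, `τ` a prime of `B` and `a ≥ 1`, then `s = u f^a` for a unit `u`
and a prime `f` of `O` with `ι f = w τ`, `w ∈ B^×` (a prime factor `f` of `s` has `ι f ~ τ^b`
with `b = 1` by `le_one_of_associated_pow_mul`; then `f^a ∣ s` by faithful flatness, and the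
cofactor is a unit because `ι` is local). [folklore] -/
theorem descent_one_branch {O B : Type*} [CommRing O] [IsRegularLocalRing O] [IsDomain O]
    [CommRing B] [IsDomain B] [Algebra O B] [Module.FaithfullyFlat O B]
    [IsLocalHom (algebraMap O B)]
    (hexc : ∀ f₁ : O, Prime f₁ → IsReduced (B ⧸ Ideal.span {algebraMap O B f₁}))
    {τ r : B} (hτ : Prime τ) (hr : IsUnit r) {s : O} {a : ℕ} (ha : a ≠ 0)
    (hs : algebraMap O B s = r * τ ^ a) :
    ∃ (f u : O) (w : B), Prime f ∧ IsUnit u ∧ IsUnit w ∧ algebraMap O B f = w * τ ∧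
      s = u * f ^ a := by
  obtain ⟨f, hf, hfs⟩ := exists_prime_dvd_of_algebraMap_eq
    (mul_ne_zero hr.ne_zero (pow_ne_zero _ hτ.ne_zero))
    (fun h => hτ.not_unit ((isUnit_pow_iff ha).mp (isUnit_of_mul_isUnit_right h))) hs
  have hfd : algebraMap O B f ∣ τ ^ a := (hr.dvd_mul_left).mp (hs ▸ map_dvd (algebraMap O B) hfs)
  obtain ⟨b, -, hfb⟩ := (dvd_prime_pow hτ a).mp hfd
  have hb1 : b ≤ 1 := le_one_of_associated_pow_mul (hexc f hf) (by simpa using hfb) hτ.ne_zero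
    (fun h => hτ.not_unit (isUnit_of_dvd_one h))
  have hb0 : b ≠ 0 := by
    rintro rfl
    rw [pow_zero] at hfb
    exact hf.not_unit ((isUnit_map_iff (algebraMap O B) f).mp (associated_one_iff_isUnit.mp hfb))
  obtain rfl : b = 1 := by omega
  rw [pow_one] at hfb
  obtain ⟨v, hv⟩ := hfb
  obtain ⟨u, rfl, hu⟩ := exists_eq_mul_of_algebraMap_eq_mul (pow_ne_zero a hf.ne_zero)
    (c := r * (v : B) ^ a) (s := s) (by rw [hs, ← hv, map_pow]; ring)
  refine ⟨f, u, ↑v⁻¹, hf, ?_, Units.isUnit _, ?_, rfl⟩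
  · refine (isUnit_map_iff (algebraMap O B) u).mp ?_
    rw [hu]
    exact hr.mul ((Units.isUnit v).pow a)
  · rw [← hv, mul_comm (algebraMap O B f), Units.inv_mul_cancel_left]

/-- **Two formal branches, two algebraic branches.** With `ι s = r τ₀^{a₀} τ₁^{a₁}` (`r` unit,
`τ₁` prime, `a₁ ≥ 1`) and an `f ≠ 0` with `ι f = w τ₀` (`w` unit): `s = u f^{a₀} f'^{a₁}` for a
unit `u` and a prime `f'` with `ι f' = w' τ₁` (peel `f^{a₀}` off and descend the branch `τ₁`).
[folklore] -/
theorem descent_two_branch {O B : Type*} [CommRing O] [IsRegularLocalRing O] [IsDomain O]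
    [CommRing B] [IsDomain B] [Algebra O B] [Module.FaithfullyFlat O B]
    [IsLocalHom (algebraMap O B)]
    (hexc : ∀ f₁ : O, Prime f₁ → IsReduced (B ⧸ Ideal.span {algebraMap O B f₁}))
    {τ₀ τ₁ r w : B} (h₁ : Prime τ₁) (hr : IsUnit r) (hw : IsUnit w) {s f : O} (hf0 : f ≠ 0)
    {a₀ a₁ : ℕ} (ha₁ : a₁ ≠ 0) (hs : algebraMap O B s = r * (τ₀ ^ a₀ * τ₁ ^ a₁))
    (hf : algebraMap O B f = w * τ₀) :
    ∃ (f' u : O) (w' : B), Prime f' ∧ IsUnit u ∧ IsUnit w' ∧ algebraMap O B f' = w' * τ₁ ∧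
      s = u * (f ^ a₀ * f' ^ a₁) := by
  obtain ⟨w, rfl⟩ := hw
  have hτ₀ : τ₀ = ↑w⁻¹ * algebraMap O B f := by rw [hf, Units.inv_mul_cancel_left]
  obtain ⟨s', rfl, hs'⟩ := exists_eq_mul_of_algebraMap_eq_mul (pow_ne_zero a₀ hf0)
    (c := r * (↑w⁻¹ : B) ^ a₀ * τ₁ ^ a₁) (s := s) (by rw [hs, hτ₀, map_pow]; ring)
  obtain ⟨f', u, w', hf', hu, hw', hf'w, rfl⟩ := descent_one_branch hexc h₁
    ((hr.mul ((Units.isUnit _).pow _))) ha₁ hs'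
  exact ⟨f', u, w', hf', hu, hw', hf'w, by ring⟩

/-- **Two formal branches, one algebraic branch.** With `ι s = r τ₀^{a₀} τ₁^{a₁}` (`r` unit,
`τ₀, τ₁` primes, `a₀ ≤ a₁`) and a prime `f` of `O` with `ι f = w τ₀ τ₁` (`w` unit): `a₀ = a₁`
and `s = u f^{a₀}` with `u` a unit (peel `f^{a₀}` off; a left-over power of `τ₁` would descend
to a prime `f' ∣ f`, `ι f' ~ τ₁`, making `τ₀` a unit). [folklore] -/
theorem descent_double_branch {O B : Type*} [CommRing O] [IsRegularLocalRing O] [IsDomain O]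
    [CommRing B] [IsDomain B] [Algebra O B] [Module.FaithfullyFlat O B]
    [IsLocalHom (algebraMap O B)]
    (hexc : ∀ f₁ : O, Prime f₁ → IsReduced (B ⧸ Ideal.span {algebraMap O B f₁}))
    {τ₀ τ₁ r w : B} (h₀ : Prime τ₀) (h₁ : Prime τ₁) (hr : IsUnit r) (hw : IsUnit w) {s f : O}
    (hfp : Prime f) {a₀ a₁ : ℕ} (hle : a₀ ≤ a₁)
    (hs : algebraMap O B s = r * (τ₀ ^ a₀ * τ₁ ^ a₁)) (hf : algebraMap O B f = w * (τ₀ * τ₁)) :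
    a₀ = a₁ ∧ ∃ u : O, IsUnit u ∧ s = u * f ^ a₀ := by
  obtain ⟨w, rfl⟩ := hw
  have h01 : τ₀ * τ₁ = ↑w⁻¹ * algebraMap O B f := by rw [hf, Units.inv_mul_cancel_left]
  have key : τ₀ ^ a₀ * τ₁ ^ a₁ = (↑w⁻¹ * algebraMap O B f) ^ a₀ * τ₁ ^ (a₁ - a₀) := by
    rw [← h01, mul_pow, mul_assoc, pow_mul_pow_sub _ hle]
  obtain ⟨s', rfl, hs'⟩ := exists_eq_mul_of_algebraMap_eq_mul (pow_ne_zero a₀ hfp.ne_zero)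
    (c := r * (↑w⁻¹ : B) ^ a₀ * τ₁ ^ (a₁ - a₀)) (s := s) (by rw [hs, key, map_pow]; ring)
  by_cases h : a₁ - a₀ = 0
  · rw [h, pow_zero, mul_one] at hs'
    refine ⟨by omega, s', (isUnit_map_iff (algebraMap O B) s').mp ?_, rfl⟩
    rw [hs']
    exact hr.mul ((Units.isUnit _).pow _)
  · exfalso
    obtain ⟨f', u, w', hf', -, hw', hf'w, -⟩ := descent_one_branch hexc h₁
      ((hr.mul ((Units.isUnit _).pow _))) h hs'
    obtain ⟨w', rfl⟩ := hw'
    have hτ₁ : τ₁ = ↑w'⁻¹ * algebraMap O B f' := by rw [hf'w, Units.inv_mul_cancel_left]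
    have hdvd : f' ∣ f :=
      dvd_of_algebraMap_dvd (B := B) ⟨↑w * τ₀ * ↑w'⁻¹, by rw [hf, hτ₁]; ring⟩
    obtain ⟨v, hv⟩ := hf'.associated_of_dvd hfp hdvd
    have e : τ₁ * (↑w' * algebraMap O B ↑v) = τ₁ * (↑w * τ₀) := by
      have h' := congrArg (algebraMap O B) hv
      rw [map_mul, hf'w, hf] at h'
      linear_combination h'
    have hA : ↑w' * algebraMap O B ↑v = ↑w * τ₀ := mul_left_cancel₀ h₁.ne_zero e
    have hτ₀ : τ₀ = ↑w⁻¹ * (↑w' * algebraMap O B ↑v) := by rw [hA, Units.inv_mul_cancel_left]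
    refine h₀.not_unit ?_
    rw [hτ₀]
    exact (Units.isUnit _).mul ((Units.isUnit _).mul ((Units.isUnit v).map (algebraMap O B)))

/-- **Two algebraic branches generate `𝔪`.** If `(τ₀, τ₁)` generates `𝔪 B` and
`ι f₀ = w₀ τ₀`, `ι f₁ = w₁ τ₁` with units `w₀, w₁`, then `(f₀, f₁) = 𝔪`
(`(f₀, f₁) B = 𝔪 B` and faithful flatness). [folklore] -/
theorem span_pair_eq_maximalIdeal {O B : Type*} [CommRing O] [IsLocalRing O] [CommRing B]
    [Algebra O B] [Module.FaithfullyFlat O B] {τ : Fin 2 → B}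
    (hτ : Ideal.span (Set.range τ) = (maximalIdeal O).map (algebraMap O B)) {f₀ f₁ : O}
    {w₀ w₁ : B} (hw₀ : IsUnit w₀) (hw₁ : IsUnit w₁) (h₀ : algebraMap O B f₀ = w₀ * τ 0)
    (h₁ : algebraMap O B f₁ = w₁ * τ 1) : Ideal.span {f₀, f₁} = maximalIdeal O := by
  have key : (Ideal.span {f₀, f₁}).map (algebraMap O B) =
      (maximalIdeal O).map (algebraMap O B) := by
    rw [← hτ, Ideal.map_span, Set.image_pair, h₀, h₁, ideal_span_range_fin_two,
      Ideal.span_insert, Ideal.span_insert, Ideal.span_singleton_mul_left_unit hw₀,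
      Ideal.span_singleton_mul_left_unit hw₁]
  have h := congrArg (Ideal.comap (algebraMap O B)) key
  rwa [Ideal.comap_map_eq_self_of_faithfullyFlat,
    Ideal.comap_map_eq_self_of_faithfullyFlat] at h

/-! ## The nodal congruence in the completion -/

/-- **The nodal congruence.** If `(τ₀, τ₁)` generates `maximalIdeal Ô` and `ι f = w τ₀ τ₁` with
`w` a unit, then `f ≡ c t₁ t₂ (mod 𝔪³)` for a unit `c` and a regular system of parameters
`(t₁, t₂)` of `O`: adapted parameters `ι t_j ≡ τ_j (mod 𝔪̂²)` (`exists_coord_adapted`),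
`ι c ≡ w (mod 𝔪̂)`, and `𝔪̂³ ∩ O = 𝔪³`. [folklore] -/
theorem nodal_congruence {O : Type u} [CommRing O] [IsRegularLocalRing O]
    {τ : Fin 2 → AdicCompletion (maximalIdeal O) O}
    (hτ : Ideal.span (Set.range τ) = maximalIdeal (AdicCompletion (maximalIdeal O) O))
    {f : O} {w : AdicCompletion (maximalIdeal O) O} (hw : IsUnit w)
    (hf : algebraMap O (AdicCompletion (maximalIdeal O) O) f = w * (τ 0 * τ 1)) :
    ∃ c t₁ t₂ : O, IsUnit c ∧ Ideal.span {t₁, t₂} = maximalIdeal O ∧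
      f - c * t₁ * t₂ ∈ maximalIdeal O ^ 3 := by
  obtain ⟨t, ht, hspan⟩ := exists_coord_adapted τ hτ
  obtain ⟨c, hc⟩ : ∃ c : O, algebraMap O (AdicCompletion (maximalIdeal O) O) c - w ∈
      maximalIdeal (AdicCompletion (maximalIdeal O) O) := by
    obtain ⟨c, hc⟩ := exists_sub_algebraMap_mem_maximalIdeal_adicCompletion w
    exact ⟨c, by rw [← neg_sub]; exact neg_mem hc⟩
  have hτm : ∀ j, τ j ∈ maximalIdeal (AdicCompletion (maximalIdeal O) O) := fun j =>
    hτ ▸ Ideal.subset_span ⟨j, rfl⟩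
  have htm : ∀ j, algebraMap O (AdicCompletion (maximalIdeal O) O) (t j) ∈
      maximalIdeal (AdicCompletion (maximalIdeal O) O) := fun j =>
    map_nonunit (algebraMap O _) (t j) (hspan ▸ Ideal.subset_span ⟨j, rfl⟩)
  refine ⟨c, t 0, t 1, ?_, ?_, ?_⟩
  · by_contra hcu
    have hcm : algebraMap O (AdicCompletion (maximalIdeal O) O) c ∈
        maximalIdeal (AdicCompletion (maximalIdeal O) O) :=
      map_nonunit (algebraMap O _) c ((mem_maximalIdeal c).mpr (mem_nonunits_iff.mpr hcu))
    have hwm : w ∈ maximalIdeal (AdicCompletion (maximalIdeal O) O) := by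
      have e : w = algebraMap O (AdicCompletion (maximalIdeal O) O) c -
          (algebraMap O (AdicCompletion (maximalIdeal O) O) c - w) := by ring
      rw [e]
      exact sub_mem hcm hc
    exact mem_nonunits_iff.mp ((mem_maximalIdeal w).mp hwm) hw
  · rw [← hspan, ideal_span_range_fin_two]
  · rw [← Ideal.comap_map_eq_self_of_faithfullyFlat (B := AdicCompletion (maximalIdeal O) O)
      (maximalIdeal O ^ 3), Ideal.mem_comap, Ideal.map_pow, ← AdicCompletion.maximalIdeal_eq_map]
    have e : algebraMap O (AdicCompletion (maximalIdeal O) O) (f - c * t 0 * t 1) =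
        -((algebraMap O _ c - w) * τ 0 * τ 1 +
          algebraMap O _ c * (algebraMap O _ (t 0) - τ 0) * τ 1 +
          algebraMap O _ c * algebraMap O _ (t 0) * (algebraMap O _ (t 1) - τ 1)) := by
      simp only [map_sub, map_mul, hf]
      ring
    rw [e]
    refine neg_mem (add_mem (add_mem ?_ ?_) ?_)
    · rw [pow_three']
      exact Ideal.mul_mem_mul (Ideal.mul_mem_mul hc (hτm 0)) (hτm 1)
    · rw [pow_succ]
      exact Ideal.mul_mem_mul (Ideal.mul_mem_left _ _ (ht 0)) (hτm 1)
    · rw [pow_succ']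
      exact Ideal.mul_mem_mul (Ideal.mul_mem_left _ _ (htm 0)) (ht 1)

end Literature.AlgebraicGeometry.Resolution

end
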